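import Summits.Ventures.Crystal3D.Theorems.StickyWulffConstantStackingLiminfOptimalCalibrationValue
import HarnessLib

/-!
# The optimal calibration toward `StackingLiminf` (stmt-Ventures-19145): the OPTIMAL value
# estimate `B_c·M − K'_c·√M ≤ 2G(M)` (cf-p2 R20 blueprint L5, integral-free form)

Route `StickyWulffConstant` of the venture `Summits/Ventures/Crystal3D` (cell `crystal3d-full`).
`…OptimalCalibrationValue.lean` proved the tangent-line estimate with `B = 3 − 2c/β_c`
(`β_c = 2√3 + c`).  This file proves the estimate with the OPTIMAL constant
`B_c = 3 − (2/c)(2β_c/3 − 2√3 + 8√3/β_c²) = 1 + (2/3)(36 + 6√3c + c²)/β_c²` (`B_alt`) and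
`K'_c = c + 2√3/c + 4β_c/(c√31)`:  **`B_c·M − K'_c·√M ≤ 2·G(M)` for `M ≥ 31`**
(`B_mul_le_two_mul_G_top`).  With `27β_c²B_c/4 = 243 + 54√3·c + 45c²/4` (`ceiling_identity`) this
is the value behind the ladder's exact ceiling `∛347.78 = 7.0324` (`c = 1`, input `layerProfile`) /
`∛397.77 = 7.3544` (`c = √2`, input `layerProfileSharp`) of cf-p2 R20 (kit j262960/j263200/j262988).
Proof (cf-p2 g10, `HOME/cf-p2/OptimalCalibrationSketch.lean`, evidence #18 on stmt-Ventures-19145 —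
the planner's integral-free argument, landed here with the antiderivative passed as an explicit
function `H` instead of a definition): `2G(M) = 3M − (2/c)Σφ₊ − (c√M − δ)` (`two_mul_G_top`);
`φ₊(m) ≤ (l√m − 2√3)₊ + √3/(2m)` with `l = β_c/√M` (`phiPos_le`); the positive parts are dominated
by the increments of the CLIPPED antiderivative `x ↦ H(max x x₀)`,
`H(x) = (2l/3)x√x − 2√3x`, `x₀ = 12M/β_c²` its critical point (`posPart_le_H_sub`, telescoped in
`sum_posPart_le_H`; `H(x₀) = −8√3M/β_c²`, `H(M+1) ≤ (2β_c/3)M + 2β_c − 2√3(M+1)`), and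
`Σ_{m ≤ M} 1/m ≤ 2√M`.
WHAT THIS IS NOT: not the rung (assembly with an `M`-dependent `ω_M` = separate file); no claim
about the crux `StackingLiminf` (∛432); rung F-C1 not moved.
-/

noncomputable section

namespace Summit.Ventures.Crystal3D.Theorems.OptimalCalibration

open Finset

/-! ### Termwise bound on `φ₊` -/

/-- L5(c): `φ₊(m) ≤ (β_c √m/√M − 2√3)₊ + √3/(2m)` for `1 ≤ m`
(`ω_M ≤ β_c`, `s(m) ≥ 2√3 − √3/(2m)`). -/
theorem phiPos_le {c δ : ℝ} (hδ : 0 ≤ δ) {M : ℕ} (hM : 31 ≤ M) {m : ℕ} (hm : 1 ≤ m) :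
    max (phi c δ M m) 0 ≤
      max ((2 * Real.sqrt 3 + c) * Real.sqrt m / Real.sqrt M - 2 * Real.sqrt 3) 0
        + Real.sqrt 3 / (2 * m) := by
  have hM' : (31 : ℝ) ≤ M := by exact_mod_cast hM
  have hsMpos : 0 < Real.sqrt M := Real.sqrt_pos.2 (by linarith)
  have hω := omega_le c hδ M
  have hsm := s_ge_sub m hm
  have hpos : 0 ≤ Real.sqrt 3 / (2 * (m : ℝ)) := by positivity
  have hφ : phi c δ M m ≤ (2 * Real.sqrt 3 + c) * Real.sqrt m / Real.sqrt M - 2 * Real.sqrt 3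
      + Real.sqrt 3 / (2 * m) := by
    unfold phi
    have h1 : omega c δ M * Real.sqrt m / Real.sqrt M ≤
        (2 * Real.sqrt 3 + c) * Real.sqrt m / Real.sqrt M := by
      apply div_le_div_of_nonneg_right _ hsMpos.le
      exact mul_le_mul_of_nonneg_right hω (Real.sqrt_nonneg _)
    linarith
  refine max_le ?_ (by
    linarith [le_max_right ((2 * Real.sqrt 3 + c) * Real.sqrt m / Real.sqrt M - 2 * Real.sqrt 3) 0])
  linarith [le_max_left ((2 * Real.sqrt 3 + c) * Real.sqrt m / Real.sqrt M - 2 * Real.sqrt 3) 0]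

/-! ### Integral-free comparison lemmas for `√` -/

/-- L5(a): `√x ≤ (2/3)((x+1)√(x+1) − x√x)` (the integral-free `√x ≤ ∫_x^{x+1} √`). -/
theorem sqrt_le_two_thirds_sub {x : ℝ} (hx : 0 ≤ x) :
    Real.sqrt x ≤ 2 / 3 * ((x + 1) * Real.sqrt (x + 1) - x * Real.sqrt x) := by
  set u := Real.sqrt x with hu
  set v := Real.sqrt (x + 1) with hv
  have hu0 : 0 ≤ u := Real.sqrt_nonneg _
  have hv0 : 0 ≤ v := Real.sqrt_nonneg _
  have hu2 : u ^ 2 = x := by rw [hu]; exact Real.sq_sqrt hx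
  have hv2 : v ^ 2 = x + 1 := by rw [hv]; exact Real.sq_sqrt (by linarith)
  have huv : u ≤ v := by rw [hu, hv]; exact Real.sqrt_le_sqrt (by linarith)
  have hx1 : x + 1 = v ^ 2 := hv2.symm
  have hx0 : x = u ^ 2 := hu2.symm
  rw [hx1, hx0] at *
  nlinarith [mul_nonneg (sub_nonneg.2 huv) (by positivity : 0 ≤ 2 * v + u), hv2, hu2]

/-- The reverse comparison `(2/3)((x+1)√(x+1) − x√x) ≤ √(x+1)` (`∫_x^{x+1} √ ≤ √(x+1)`). -/
theorem two_thirds_sub_le {x : ℝ} (hx : 0 ≤ x) :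
    2 / 3 * ((x + 1) * Real.sqrt (x + 1) - x * Real.sqrt x) ≤ Real.sqrt (x + 1) := by
  set u := Real.sqrt x with hu
  set v := Real.sqrt (x + 1) with hv
  have hu0 : 0 ≤ u := Real.sqrt_nonneg _
  have hv0 : 0 ≤ v := Real.sqrt_nonneg _
  have hu2 : u ^ 2 = x := by rw [hu]; exact Real.sq_sqrt hx
  have hv2 : v ^ 2 = x + 1 := by rw [hv]; exact Real.sq_sqrt (by linarith)
  have huv : u ≤ v := by rw [hu, hv]; exact Real.sqrt_le_sqrt (by linarith)
  have hx1 : x + 1 = v ^ 2 := hv2.symm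
  have hx0 : x = u ^ 2 := hu2.symm
  have key : v * (u ^ 2 + 1 - v ^ 2) = 0 := by rw [hu2, hv2]; ring
  rw [hx1, hx0] at *
  nlinarith [mul_nonneg (sq_nonneg (v - u)) (by linarith : (0:ℝ) ≤ v + 2 * u), key, hv0]

/-! ### The clipped antiderivative `H(x) = (2l/3)x√x − 2√3x` of `g(x) = l√x − 2√3`
(passed as an explicit function `H` with its defining equation `hH`) -/

/-- `g(x) ≤ H(x+1) − H(x)` for `x ≥ 0` (`g` increasing). -/
theorem g_le_H_sub {l : ℝ} {H : ℝ → ℝ}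
    (hH : ∀ x, H x = 2 * l / 3 * (x * Real.sqrt x) - 2 * Real.sqrt 3 * x)
    (hl : 0 ≤ l) {x : ℝ} (hx : 0 ≤ x) :
    l * Real.sqrt x - 2 * Real.sqrt 3 ≤ H (x + 1) - H x := by
  have h := mul_le_mul_of_nonneg_left (sqrt_le_two_thirds_sub hx) hl
  have e : H (x + 1) - H x =
      l * (2 / 3 * ((x + 1) * Real.sqrt (x + 1) - x * Real.sqrt x)) - 2 * Real.sqrt 3 := by
    rw [hH, hH]; ring
  rw [e]; linarith

/-- `H` is nondecreasing to the right of its critical point `x₀` (`l√x₀ = 2√3`):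
`H(x₀) ≤ H(y)` for `y ≥ x₀` — indeed `H(y) − H(x₀) = (l/3)(√y − √x₀)²(2√y + √x₀)`. -/
theorem H_mono {l : ℝ} {H : ℝ → ℝ}
    (hH : ∀ x, H x = 2 * l / 3 * (x * Real.sqrt x) - 2 * Real.sqrt 3 * x)
    (hl : 0 ≤ l) {x0 y : ℝ} (hx0 : 0 ≤ x0) (hy : x0 ≤ y)
    (hlx : l * Real.sqrt x0 = 2 * Real.sqrt 3) : H x0 ≤ H y := by
  have hy0 : 0 ≤ y := le_trans hx0 hy
  rw [hH, hH, ← hlx]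
  set u := Real.sqrt x0 with hu
  set v := Real.sqrt y with hv
  have hu0 : 0 ≤ u := Real.sqrt_nonneg _
  have hv0 : 0 ≤ v := Real.sqrt_nonneg _
  have hu2 : u ^ 2 = x0 := by rw [hu]; exact Real.sq_sqrt hx0
  have hv2 : v ^ 2 = y := by rw [hv]; exact Real.sq_sqrt hy0
  have huv : u ≤ v := by rw [hu, hv]; exact Real.sqrt_le_sqrt hy
  have hx0' : x0 = u ^ 2 := hu2.symm
  have hy' : y = v ^ 2 := hv2.symm
  rw [hx0', hy']
  nlinarith [mul_nonneg (mul_nonneg hl (sq_nonneg (v - u))) (by linarith : (0:ℝ) ≤ 2 * v + u)]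

/-- The positive part is dominated by the increment of the CLIPPED antiderivative
`x ↦ H(max x x₀)`: `(l√x − 2√3)₊ ≤ H(max (x+1) x₀) − H(max x x₀)` for `x ≥ 0`. -/
theorem posPart_le_H_sub {l : ℝ} {H : ℝ → ℝ}
    (hH : ∀ x, H x = 2 * l / 3 * (x * Real.sqrt x) - 2 * Real.sqrt 3 * x)
    (hl : 0 ≤ l) {x0 x : ℝ} (hx0 : 0 ≤ x0) (hx : 0 ≤ x)
    (hlx : l * Real.sqrt x0 = 2 * Real.sqrt 3) :
    max (l * Real.sqrt x - 2 * Real.sqrt 3) 0 ≤ H (max (x + 1) x0) - H (max x x0) := by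
  have gle : ∀ y, y ≤ x0 → l * Real.sqrt y - 2 * Real.sqrt 3 ≤ 0 := by
    intro y hy
    have := mul_le_mul_of_nonneg_left (Real.sqrt_le_sqrt hy) hl
    linarith
  have gge : ∀ y, x0 ≤ y → 0 ≤ l * Real.sqrt y - 2 * Real.sqrt 3 := by
    intro y hy
    have := mul_le_mul_of_nonneg_left (Real.sqrt_le_sqrt hy) hl
    linarith
  rcases le_total x0 x with h1 | h1
  · rw [max_eq_left (by linarith : x0 ≤ x + 1), max_eq_left h1]
    have hg := g_le_H_sub hH hl hx
    exact max_le hg (by linarith [gge x h1])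
  · rcases le_total x0 (x + 1) with h2 | h2
    · rw [max_eq_left h2, max_eq_right h1]
      have hm := H_mono hH hl hx0 h2 hlx
      exact max_le (by linarith [gle x h1]) (by linarith)
    · rw [max_eq_right h2, max_eq_right h1, sub_self]
      exact max_le (gle x h1) le_rfl

/-- Telescoped: `Σ_{m<M} (l√(m+1) − 2√3)₊ ≤ H(M+1) − H(x₀)` when `0 ≤ x₀ ≤ M+1`
(the integral-free form of `Σ g₊ ≤ ∫ g₊`). -/
theorem sum_posPart_le_H {l : ℝ} {H : ℝ → ℝ}
    (hH : ∀ x, H x = 2 * l / 3 * (x * Real.sqrt x) - 2 * Real.sqrt 3 * x)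
    (hl : 0 ≤ l) {x0 : ℝ} (hx0 : 0 ≤ x0)
    (hlx : l * Real.sqrt x0 = 2 * Real.sqrt 3) (M : ℕ) (hMx : x0 ≤ (M:ℝ) + 1) :
    ∑ m ∈ range M, max (l * Real.sqrt ((m:ℝ) + 1) - 2 * Real.sqrt 3) 0 ≤
      H ((M:ℝ) + 1) - H x0 := by
  have step : ∀ m ∈ range M, max (l * Real.sqrt ((m:ℝ) + 1) - 2 * Real.sqrt 3) 0 ≤
      H (max ((m:ℝ) + 1 + 1) x0) - H (max ((m:ℝ) + 1) x0) := by
    intro m _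
    exact posPart_le_H_sub hH hl hx0 (by positivity) hlx
  have tele : ∀ n : ℕ, ∑ m ∈ range n,
      (H (max ((m:ℝ) + 1 + 1) x0) - H (max ((m:ℝ) + 1) x0)) =
      H (max ((n:ℝ) + 1) x0) - H (max 1 x0) := by
    intro n
    induction n with
    | zero => simp
    | succ n ih =>
      rw [Finset.sum_range_succ, ih]
      push_cast
      ring
  have hmax1 : H x0 ≤ H (max 1 x0) := H_mono hH hl hx0 (le_max_right _ _) hlx
  have hmaxM : max ((M:ℝ) + 1) x0 = (M:ℝ) + 1 := max_eq_left hMx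
  calc ∑ m ∈ range M, max (l * Real.sqrt ((m:ℝ) + 1) - 2 * Real.sqrt 3) 0
      ≤ ∑ m ∈ range M, (H (max ((m:ℝ) + 1 + 1) x0) - H (max ((m:ℝ) + 1) x0)) :=
        Finset.sum_le_sum step
    _ = H (max ((M:ℝ) + 1) x0) - H (max 1 x0) := tele M
    _ ≤ H ((M:ℝ) + 1) - H x0 := by rw [hmaxM]; linarith

/-! ### The optimal value estimate -/

/-- **L5 with the optimal constant (cf-p2 R20), integral-free.**  With `β_c = 2√3 + c`,
`B_c = 3 − (2/c)(2β_c/3 − 2√3 + 8√3/β_c²)` ( = `1 + (2/3)(36 + 6√3·c + c²)/β_c²`, `B_alt`) and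
`K'_c = c + 2√3/c + 4β_c/(c√31)`:  `B_c·M − K'_c·√M ≤ 2·G(M)` for `M ≥ 31`, `c > 0`, `δ ≥ 0`.
Proof: `2G(M) = 3M − (2/c)Σφ₊ − (c√M − δ)` (`two_mul_G_top`); `φ₊(m) ≤ (l√m − 2√3)₊ + √3/(2m)`,
`l = β_c/√M` (`phiPos_le`); the positive parts are dominated by the clipped antiderivative
(`sum_posPart_le_H`, evaluated: `H(x₀) = −8√3M/β_c²` at `x₀ = 12M/β_c²`,
`H(M+1) ≤ (2β_c/3)M + 2β_c − 2√3(M+1)`), and `Σ_{m ≤ M} 1/m ≤ 2√M` (`sum_inv_le_two_sqrt`). -/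
theorem B_mul_le_two_mul_G_top {c δ : ℝ} (hc : 0 < c) (hδ : 0 ≤ δ) {M : ℕ} (hM : 31 ≤ M) :
    (3 - 2 / c * (2 * (2 * Real.sqrt 3 + c) / 3 - 2 * Real.sqrt 3
        + 8 * Real.sqrt 3 / (2 * Real.sqrt 3 + c) ^ 2)) * (M : ℝ)
      - (c + 2 * Real.sqrt 3 / c + 4 * (2 * Real.sqrt 3 + c) / (c * Real.sqrt 31))
          * Real.sqrt M ≤ 2 * G c δ M M := by
  have hM' : (31:ℝ) ≤ M := by exact_mod_cast hM
  have hMpos : (0:ℝ) < M := by linarith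
  rw [two_mul_G_top hc hM]
  obtain ⟨t, ht⟩ : ∃ t, t = Real.sqrt 3 := ⟨_, rfl⟩
  obtain ⟨β, hβ⟩ : ∃ β, β = 2 * Real.sqrt 3 + c := ⟨_, rfl⟩
  obtain ⟨sM, hsM⟩ : ∃ s, s = Real.sqrt (M:ℝ) := ⟨_, rfl⟩
  rw [← hβ, ← hsM, ← ht]
  rw [← ht] at hβ
  have h3 : t ^ 2 = 3 := by rw [ht]; exact Real.sq_sqrt (by norm_num)
  have htpos : 0 < t := by rw [ht]; exact Real.sqrt_pos.2 (by norm_num)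
  have hβpos : 0 < β := by rw [hβ]; positivity
  have hβne : β ≠ 0 := hβpos.ne'
  have hcne : c ≠ 0 := hc.ne'
  have hsMpos : 0 < sM := by rw [hsM]; exact Real.sqrt_pos.2 hMpos
  have hsMne : sM ≠ 0 := hsMpos.ne'
  have hsM2 : sM ^ 2 = M := by rw [hsM]; exact Real.sq_sqrt hMpos.le
  have hs31pos : 0 < Real.sqrt 31 := Real.sqrt_pos.2 (by norm_num)
  have hsM31 : Real.sqrt 31 ≤ sM := by rw [hsM]; exact Real.sqrt_le_sqrt hM'
  have hβ2 : β ^ 2 = 12 + 4 * t * c + c ^ 2 := by rw [hβ]; linear_combination 4 * h3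
  have hβ2ge : 12 ≤ β ^ 2 := by rw [hβ2]; nlinarith [htpos, hc]
  -- parameters of the comparison function and the antiderivative (explicit, no definition)
  obtain ⟨l, hl⟩ : ∃ l, l = β / sM := ⟨_, rfl⟩
  obtain ⟨x0, hx0⟩ : ∃ x, x = 12 * (M:ℝ) / β ^ 2 := ⟨_, rfl⟩
  obtain ⟨H, hH⟩ : ∃ H : ℝ → ℝ, ∀ x, H x = 2 * l / 3 * (x * Real.sqrt x) - 2 * Real.sqrt 3 * x :=
    ⟨fun x => 2 * l / 3 * (x * Real.sqrt x) - 2 * Real.sqrt 3 * x, fun _ => rfl⟩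
  have hlpos : 0 < l := by rw [hl]; exact div_pos hβpos hsMpos
  have hx0nn : 0 ≤ x0 := by rw [hx0]; positivity
  have h12 : Real.sqrt 12 = 2 * t := by
    rw [ht, show (12:ℝ) = 2 ^ 2 * 3 by norm_num, Real.sqrt_mul (by norm_num),
      Real.sqrt_sq (by norm_num)]
  have hsx0 : Real.sqrt x0 = 2 * t * sM / β := by
    rw [hx0, Real.sqrt_div (by positivity) (β ^ 2), Real.sqrt_sq hβpos.le,
        Real.sqrt_mul (by norm_num) (M:ℝ), h12, ← hsM]
  have hlx : l * Real.sqrt x0 = 2 * t := by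
    rw [hsx0, hl, div_mul_div_comm, div_eq_iff (by positivity)]
    ring
  have hlx' : l * Real.sqrt x0 = 2 * Real.sqrt 3 := by rw [hlx, ht]
  have hx0M : x0 ≤ (M:ℝ) + 1 := by
    rw [hx0, div_le_iff₀ (by positivity)]
    nlinarith [mul_nonneg hMpos.le (sub_nonneg.2 hβ2ge), hβ2ge]
  -- (1) termwise: φ₊(m+1) ≤ (l√(m+1) − 2√3)₊ + (t/2)·(1/(m+1))
  have hterm : ∀ m ∈ range M, max (phi c δ M (m + 1)) 0 ≤
      max (l * Real.sqrt ((m:ℝ) + 1) - 2 * Real.sqrt 3) 0 + t / 2 * (1 / ((m:ℝ) + 1)) := by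
    intro m _
    have h := phiPos_le (c := c) (δ := δ) (M := M) hδ hM (m := m + 1) (by omega)
    push_cast at h
    have e1 : (2 * Real.sqrt 3 + c) * Real.sqrt ((m:ℝ) + 1) / Real.sqrt (M:ℝ)
        = l * Real.sqrt ((m:ℝ) + 1) := by
      rw [hl, hβ, hsM, ht]; ring
    have e2 : Real.sqrt 3 / (2 * ((m:ℝ) + 1)) = t / 2 * (1 / ((m:ℝ) + 1)) := by
      rw [ht, mul_one_div, div_div]
    rw [e1, e2] at h
    exact h
  -- (2) sum: Σ φ₊ ≤ (H(M+1) − H(x0)) + t·√M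
  have hsum : ∑ m ∈ range M, max (phi c δ M (m + 1)) 0 ≤
      (H ((M:ℝ) + 1) - H x0) + t * sM := by
    have h1 := sum_posPart_le_H hH hlpos.le hx0nn hlx' M hx0M
    have h2 : ∑ m ∈ range M, 1 / ((m:ℝ) + 1) ≤ 2 * sM := by
      have h := sum_inv_le_two_sqrt M
      push_cast at h
      rw [hsM]; exact h
    have ht2 : 0 ≤ t / 2 := by positivity
    have h2' := mul_le_mul_of_nonneg_left h2 ht2
    calc ∑ m ∈ range M, max (phi c δ M (m + 1)) 0
        ≤ ∑ m ∈ range M, (max (l * Real.sqrt ((m:ℝ) + 1) - 2 * Real.sqrt 3) 0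
            + t / 2 * (1 / ((m:ℝ) + 1))) := Finset.sum_le_sum hterm
      _ = ∑ m ∈ range M, max (l * Real.sqrt ((m:ℝ) + 1) - 2 * Real.sqrt 3) 0
            + t / 2 * ∑ m ∈ range M, (1 / ((m:ℝ) + 1)) := by
          rw [Finset.sum_add_distrib, Finset.mul_sum]
      _ ≤ (H ((M:ℝ) + 1) - H x0) + t / 2 * (2 * sM) := by linarith
      _ = (H ((M:ℝ) + 1) - H x0) + t * sM := by ring
  -- (3) evaluate H at x0, bound H at M+1
  have hHx0 : H x0 = -(8 * t / β ^ 2 * M) := by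
    rw [hH]
    rw [show 2 * l / 3 * (x0 * Real.sqrt x0) = 2 / 3 * x0 * (l * Real.sqrt x0) by ring, hlx,
      ← ht, hx0]
    ring
  have hHM : H ((M:ℝ) + 1) ≤ 2 * β / 3 * M + 2 * β - 2 * t * ((M:ℝ) + 1) := by
    have h1 := two_thirds_sub_le hMpos.le
    rw [← hsM] at h1
    have h2 : Real.sqrt ((M:ℝ) + 1) ≤ 2 * sM := by
      have h4 : ((M:ℝ) + 1) ≤ (2 * sM) ^ 2 := by nlinarith [hsM2, hM']
      calc Real.sqrt ((M:ℝ) + 1) ≤ Real.sqrt ((2 * sM) ^ 2) := Real.sqrt_le_sqrt h4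
        _ = 2 * sM := Real.sqrt_sq (by positivity)
    have h3' : ((M:ℝ) + 1) * Real.sqrt ((M:ℝ) + 1) ≤ M * sM + 3 * sM := by linarith [h1, h2]
    have key : 2 * l / 3 * (((M:ℝ) + 1) * Real.sqrt ((M:ℝ) + 1))
        ≤ 2 * l / 3 * (M * sM + 3 * sM) := mul_le_mul_of_nonneg_left h3' (by positivity)
    have e : 2 * l / 3 * ((M:ℝ) * sM + 3 * sM) = 2 * β / 3 * M + 2 * β := by
      rw [hl]; field_simp
    rw [hH, ← ht]
    linarith [key, e]
  -- (4) assemble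
  have hP : ∑ m ∈ range M, max (phi c δ M (m + 1)) 0 ≤
      (2 * β / 3 * M + 2 * β - 2 * t * ((M:ℝ) + 1) + 8 * t / β ^ 2 * M) + t * sM := by
    rw [hHx0] at hsum; linarith [hsum, hHM]
  have hQ := mul_le_mul_of_nonneg_left hP (show (0:ℝ) ≤ 2 / c by positivity)
  have hβ31 : 2 / c * (2 * β) ≤ 4 * β / (c * Real.sqrt 31) * sM := by
    have h1 : 1 ≤ sM / Real.sqrt 31 := by rw [le_div_iff₀ hs31pos]; linarith
    have h2 : 0 ≤ 4 * β / c := by positivity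
    calc 2 / c * (2 * β) = 4 * β / c * 1 := by ring
      _ ≤ 4 * β / c * (sM / Real.sqrt 31) := mul_le_mul_of_nonneg_left h1 h2
      _ = 4 * β / (c * Real.sqrt 31) * sM := by ring
  have hpos1 : 0 ≤ 2 / c * t := by positivity
  have eG : 2 * t / c * sM = 2 / c * (t * sM) := by ring
  linarith [hQ, hβ31, hpos1, eG, hδ]

/-- The two closed forms of `B_c` agree: `3 − (2/c)(2β/3 − 2√3 + 8√3/β²) =
1 + (2/3)(36 + 6√3c + c²)/β²` (`β = 2√3 + c`, `c > 0`). -/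
theorem B_alt {c : ℝ} (hc : 0 < c) :
    3 - 2 / c * (2 * (2 * Real.sqrt 3 + c) / 3 - 2 * Real.sqrt 3
        + 8 * Real.sqrt 3 / (2 * Real.sqrt 3 + c) ^ 2)
      = 1 + 2 / 3 * (36 + 6 * Real.sqrt 3 * c + c ^ 2) / (2 * Real.sqrt 3 + c) ^ 2 := by
  obtain ⟨t, ht⟩ : ∃ t, t = Real.sqrt 3 := ⟨_, rfl⟩
  rw [← ht]
  have h3 : t ^ 2 = 3 := by rw [ht]; exact Real.sq_sqrt (by norm_num)
  have htpos : 0 < t := by rw [ht]; exact Real.sqrt_pos.2 (by norm_num)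
  have hβpos : 0 < 2 * t + c := by positivity
  have hcne : c ≠ 0 := hc.ne'
  have hβne : 2 * t + c ≠ 0 := hβpos.ne'
  field_simp
  linear_combination (16 * t + 24 * c) * h3

/-- **The optimal value estimate in ceiling form.**  For `0 < c`, `0 ≤ δ`, `M ≥ 31`:
`B_c·M − K'_c·√M ≤ 2·G(M)` with `B_c = 1 + (2/3)(36 + 6√3c + c²)/β_c²`, so that
`27β_c²B_c/4 = 243 + 54√3·c + 45c²/4` (`ceiling_identity`). -/
theorem Bopt_mul_le_two_mul_G_top {c δ : ℝ} (hc : 0 < c) (hδ : 0 ≤ δ) {M : ℕ} (hM : 31 ≤ M) :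
    (1 + 2 / 3 * (36 + 6 * Real.sqrt 3 * c + c ^ 2) / (2 * Real.sqrt 3 + c) ^ 2) * (M : ℝ)
      - (c + 2 * Real.sqrt 3 / c + 4 * (2 * Real.sqrt 3 + c) / (c * Real.sqrt 31))
          * Real.sqrt M ≤ 2 * G c δ M M := by
  have h := B_mul_le_two_mul_G_top hc hδ hM
  rwa [B_alt hc] at h

end Summit.Ventures.Crystal3D.Theorems.OptimalCalibration

end
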